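import Summits.PneNP.PneNP.Theorems.ConvexRankGatesLinAlgGateBlindLevelHost
import Summits.PneNP.PneNP.Theorems.ConvexRankGatesLinAlgGateBlindDoorHost
import Summits.PneNP.PneNP.Theorems.ConvexRankGatesLinAlgGateBlindLogWidthDoors
import Summits.PneNP.PneNP.Theorems.ConvexRankGatesLinAlgGateBlindChainCoverOrder

/-!
# Route ConvexRankGates, crux `LinAlgGateBlind` (stmt-PneNP-10681): the GROUP-ORDER door at logarithmic atom width — every permutation gate whose group has order `≤ 2^{m^{7/8}/(log₂ m)^5}`

Support theorems for the crux (vocabulary of `Theorems/ConvexRankGatesLinAlgGateBlindDefs.lean`). The chain cover by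
group order (`sgAt_permOrder_of_chain_budget`, `…ChainCoverOrder`) covers the rejection region of a permutation term gate
whose permutations generate a group of order `≤ M` — on ANY number of points — by `≤ #𝒱(l)^{⌊log₂ M⌋}` all-off events; at
the line's width this gave `log₂ M ≤ m^{11/16}/(8 log₂ m)` (`sgAt_permOrder_of_logb_le_rpow`). At the logarithmic width
`L(c,m) = (2c+8)(⌊log₂ m⌋+1)` of `…LogWidthPerm` the bookkeeping `logWidth_common` (at `T = Λ·L·(⌊log₂ M⌋+1)`) and the
two-factor cover budget give:

* `sgAt_permOrder_logWidth` — `SGAt` for all permutation gates of group order `≤ M`, `log₂ M ≤ m^{7/8}/(log₂ m)^5`, at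
  every level `c`, eventually in `m`;
* `not_computes_clique_of_isOver_permOrder_logWidth` — **unconditionally**, for every `c`, eventually in `m`: no circuit
  with `≤ m^c` gates over `{∧₂, ∨₂} ∪ {membership gates of permutation groups of order ≤ M}`,
  `log₂ M ≤ m^{7/8}/(log₂ m)^5`, computes `CLIQUE(m, ⌈m^{1/8}⌉)`.

This subsumes the `PERM_d` door (`M = d!`) and the commutative door, and is the group-ENTROPY form of the limit `1 - δ = 7/8`
of the union-bound method. Sources: Razborov 1985, Alon–Boppana 1987 §3; the covers and host are the tree's. No new
definitions. [folklore]
-/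

-- `Summit.PneNP.PneNP.…` duplicates `PneNP` BY DESIGN (single-problem summit).
set_option linter.dupNamespace false

noncomputable section

namespace Summit.PneNP.PneNP.Theorems

open Finset Filter Literature.Computability.Complexity Razborov
open Summit.PneNP.PneNP.Cruxes.LinAlgGateBlind.DnfInvariantWideGatesSeeSmallCliques
open Summit.PneNP.PneNP.Cruxes.LinAlgGateBlind.DnfInvariantWideGatesSeeSmallCliques.DenseRegime

/-- **`SGAt` for permutation gates of group order `≤ M`, `log₂ M ≤ m^{7/8}/(log₂ m)^5`, at logarithmic width** (any
number of points), at every level `c`, eventually in `m`: `sgAt_permOrder_of_chain_budget` with the budgets of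
`logWidth_common` at `T = Λ·L·(⌊log₂ M⌋+1)` and the cover budget `#𝒱(L)^{⌊log₂ M⌋} 2^{-(ν+1)} #𝒱(L) < ε`
(`cover_budget_two_pow`, `#𝒱(L) ≤ 2^{ΛL}`). [folklore] -/
theorem sgAt_permOrder_logWidth : ∀ c : ℕ, ∀ᶠ m : ℕ in atTop, ∀ M : ℕ,
    Real.logb 2 M ≤ (m : ℝ) ^ (7 / 8 : ℝ) / Real.logb 2 m ^ 5 →
    SGAt m (fun g => ∃ (d : ℕ) (σ : Fin g.1 → Equiv.Perm (Fin d)) (τ : Equiv.Perm (Fin d)),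
        Nat.card (Subgroup.closure (Set.range σ)) ≤ M ∧
          ∀ v, g.2 v = true ↔ τ ∈ Subgroup.closure (σ '' {i | v i = true}))
      ((2 * c + 8) * (Nat.log 2 m + 1)) (kOf m) (qOf m) (epsOf c m) := by
  intro c
  filter_upwards [logWidth_common c] with m hm M hM
  have hT : ((((Nat.log 2 m + 1) * ((2 * c + 8) * (Nat.log 2 m + 1)) * (Nat.log 2 M + 1) : ℕ) : ℝ)) ≤
      16 * ((c : ℝ) + 4) * Real.logb 2 m ^ 2 * ((m : ℝ) ^ (7 / 8 : ℝ) / Real.logb 2 m ^ 5) := by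
    obtain ⟨-, -, -, -, -, -, -, -, -, -, hℓ1, h5, hΛL⟩ := hm 0 (by
      push_cast
      exact mul_nonneg (mul_nonneg (by positivity) (sq_nonneg _))
        (div_nonneg (Real.rpow_nonneg (Nat.cast_nonneg m) _) (pow_nonneg (logb_two_nonneg m) 5)))
    have hβ1 : 1 ≤ (m : ℝ) ^ (7 / 8 : ℝ) / Real.logb 2 m ^ 5 := by
      rw [le_div_iff₀ (by positivity), one_mul]; exact h5
    have hE : (Nat.log 2 M : ℝ) ≤ (m : ℝ) ^ (7 / 8 : ℝ) / Real.logb 2 m ^ 5 := by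
      have h := Real.natLog_le_logb M 2
      push_cast at h
      exact h.trans hM
    have hE1 : ((Nat.log 2 M : ℝ) + 1) ≤ 2 * ((m : ℝ) ^ (7 / 8 : ℝ) / Real.logb 2 m ^ 5) := by linarith
    push_cast
    have h0 : (0 : ℝ) ≤ ((Nat.log 2 m : ℝ) + 1) * ((2 * (c : ℝ) + 8) * ((Nat.log 2 m : ℝ) + 1)) := by positivity
    calc ((Nat.log 2 m : ℝ) + 1) * ((2 * (c : ℝ) + 8) * ((Nat.log 2 m : ℝ) + 1)) * ((Nat.log 2 M : ℝ) + 1)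
        ≤ (8 * ((c : ℝ) + 4) * Real.logb 2 m ^ 2) * (2 * ((m : ℝ) ^ (7 / 8 : ℝ) / Real.logb 2 m ^ 5)) :=
          mul_le_mul hΛL hE1 (by positivity) (by positivity)
      _ = 16 * ((c : ℝ) + 4) * Real.logb 2 m ^ 2 * ((m : ℝ) ^ (7 / 8 : ℝ) / Real.logb 2 m ^ 5) := by ring
  obtain ⟨hm1, hq0, hq1, hhalf, hε, h2t, -, hpos, hB, hmΛ, -, -, -⟩ := hm _ hT
  refine sgAt_permOrder_of_chain_budget m _ (kOf m) M _ _ (qOf m) (epsOf c m) hq0 hq1 hhalf hε h2t hpos ?_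
  have hV := card_smallSets_le_two_pow m ((2 * c + 8) * (Nat.log 2 m + 1))
  have hVR : (#(smallSets (Fin m) ((2 * c + 8) * (Nat.log 2 m + 1))) : ℝ) ≤
      (2 : ℝ) ^ ((Nat.log 2 m + 1) * ((2 * c + 8) * (Nat.log 2 m + 1))) := by exact_mod_cast hV
  refine cover_budget_two_pow (a := (Nat.log 2 m + 1) * ((2 * c + 8) * (Nat.log 2 m + 1)) * Nat.log 2 M)
    (Λ := Nat.log 2 m + 1) hm1 (by positivity) ?_ hVR ?_ hmΛ
  · calc (#(smallSets (Fin m) ((2 * c + 8) * (Nat.log 2 m + 1))) : ℝ) ^ Nat.log 2 M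
        ≤ ((2 : ℝ) ^ ((Nat.log 2 m + 1) * ((2 * c + 8) * (Nat.log 2 m + 1)))) ^ Nat.log 2 M :=
          pow_le_pow_left₀ (Nat.cast_nonneg _) hVR _
      _ = (2 : ℝ) ^ ((Nat.log 2 m + 1) * ((2 * c + 8) * (Nat.log 2 m + 1)) * Nat.log 2 M) := (pow_mul _ _ _).symm
  · have h1 : (Nat.log 2 m + 1) * ((2 * c + 8) * (Nat.log 2 m + 1)) * Nat.log 2 M +
        (Nat.log 2 m + 1) * ((2 * c + 8) * (Nat.log 2 m + 1)) =
        (Nat.log 2 m + 1) * ((2 * c + 8) * (Nat.log 2 m + 1)) * (Nat.log 2 M + 1) := by ring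
    omega

/-- **Monotone circuits with membership gates of permutation groups of order `≤ M`, `log₂ M ≤ m^{7/8}/(log₂ m)^5`, are
blind to `CLIQUE(m, ⌈m^{1/8}⌉)` (unconditional; any number of points).** Level-`l` door theorem at `L(c,m)` +
`isTermGate_permOrder_collapse` + `sgAt_permOrder_logWidth`. [folklore] -/
theorem not_computes_clique_of_isOver_permOrder_logWidth : ∀ c : ℕ, ∀ᶠ m : ℕ in atTop, ∀ M : ℕ,
    Real.logb 2 M ≤ (m : ℝ) ^ (7 / 8 : ℝ) / Real.logb 2 m ^ 5 →
    ∀ C : Circuit (KEdge m), C.IsOver ({GateFn.and 2, GateFn.or 2} ∪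
      {g | ∃ (d : ℕ) (σ : Fin g.1 → Equiv.Perm (Fin d)) (τ : Equiv.Perm (Fin d)),
        Nat.card (Subgroup.closure (Set.range σ)) ≤ M ∧
          ∀ v, g.2 v = true ↔ τ ∈ Subgroup.closure (σ '' {i | v i = true})}) →
      C.size ≤ m ^ c → ¬ C.Computes (cliqueFn m ⌈(m : ℝ) ^ (1 / 8 : ℝ)⌉₊) := by
  intro c
  filter_upwards [not_computes_clique_of_collapse_level c, sgAt_permOrder_logWidth c, logWidth_le_lOf c]
    with m hm hP hLl M hM C hC hsize
  refine hm _ (Nat.le_mul_of_pos_right _ (Nat.succ_pos _)) hLl _ _ (fun g hg => ?_) (fun g hg A hA => ?_)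
    (hP M hM) C hC hsize
  · obtain ⟨d, σ, τ, -, h⟩ := Set.mem_setOf_eq ▸ hg
    exact monotone_of_closure_gate g σ τ h
  · exact isTermGate_permOrder_collapse m _ M g A hA hg

/-- **In particular for every `PERM_d` with `log₂ d! ≤ m^{7/8}/(log₂ m)^5`** (`M = d!`; the group generated by
`σ : _ → Sym(d')`, `d' ≤ d`, has order `≤ d'! ≤ d!`): the `PERM_d` door in its sharpest (entropy) form. [folklore] -/
theorem not_computes_clique_of_isOver_perm_factorial_logWidth : ∀ c : ℕ, ∀ᶠ m : ℕ in atTop, ∀ d : ℕ,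
    Real.logb 2 (d.factorial) ≤ (m : ℝ) ^ (7 / 8 : ℝ) / Real.logb 2 m ^ 5 →
    ∀ C : Circuit (KEdge m), C.IsOver ({GateFn.and 2, GateFn.or 2} ∪ {g | IsPermGate d g}) →
      C.size ≤ m ^ c → ¬ C.Computes (cliqueFn m ⌈(m : ℝ) ^ (1 / 8 : ℝ)⌉₊) := by
  intro c
  filter_upwards [not_computes_clique_of_isOver_permOrder_logWidth c] with m hm d hd C hC hsize
  refine hm d.factorial (by exact_mod_cast hd) C (fun gt hgt => ?_) hsize
  rcases hC gt hgt with h | h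
  · exact Or.inl h
  · exact Or.inr (isPermGate_permOrder h)

end Summit.PneNP.PneNP.Theorems

end
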